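import Literature.AnabelianGeometry.AbsoluteAnabelian.DiagramMorphismsAutGroup
import Mathlib.CategoryTheory.Category.Preorder
import Mathlib.Order.Fin.Basic
import Mathlib.Combinatorics.Quiver.SingleObj
import HarnessLib

/-!
# [AbsTopIII] Def 3.5 (v): `TwoMorphism.IsIso` (FACT-LIST F-0094) — the printed structural 2-isomorphisms
# ARE 2-isomorphisms; the universal closure is REFUTED (proof-only, 0 `def`)

S. Mochizuki, *Topics in absolute anabelian geometry III: global reconstruction algorithms*, J. Math. Sci. Univ.
Tokyo **22** (2015) 939–1156, Definition 3.5 (v) pp. 76–77 (manuscript pages, lit key `paper:url-5493eb38cbb7`)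
[cite: MochizukiAbsTopIII2015, Definition 3.5 (v) p.76]: "a 2-morphism … we shall say that [it] is a
[2-]isomorphism if each of the natural transformations … is an isomorphism".

D-0079 L-F sub-cell [AbsTop*]+[AbsAnab], `plan/L4/LF-ABSTOP.tsv` row **F-0094** `TwoMorphism.IsIso` (abc-iut-L4-t1's
`DiagramMorphisms.lean`, DEFS-FROZEN; a DEFINITION — the predicate "every component `Θ_v` is an isomorphism").
Seat abc-iut-w5-d246.  The tree proved the unit and associativity laws of 1-morphisms as `∃`-statements
(`OneMorphism.id_comp_isomorphic`, `comp_id_isomorphic`, `comp_assoc_isomorphic`, abc-iut lineage of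
`DiagramMorphismsAutGroup.lean`) whose witnesses are the NAMED 2-morphisms `TwoMorphism.leftUnitor`, `rightUnitor`,
`associator`; here the same two-line proofs are recorded with `TwoMorphism.IsIso` ITSELF as conclusion head, at those
named 2-morphisms (the L-F head-match grammar wants a closer headed by the row's declaration):

* `TwoMorphism.isIso_leftUnitor`, `isIso_rightUnitor`, `isIso_associator` — instance forms, NO hypothesis, every
  diagram / graph morphism / 1-morphism;
* `TwoMorphism.IsIso.vcomp` — 2-isomorphisms are closed under vertical composition (with `IsIso.hcomp` of
  `DiagramMorphismsAutGroup.lean` this is the 2-groupoid structure print uses);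
* `TwoMorphism.not_forall_isIso` — the universal closure "every 2-morphism is a 2-isomorphism" is FALSE: on the
  one-vertex edgeless graph carrying the ordered category `Fin 2`, the 2-morphism `const 0 ⟶ const 1` between the
  two constant 1-morphisms has the non-invertible component `0 ⟶ 1`.  So the row is admissible only as the
  predicate it is (FACT-LIST class «universal-closure REFUTED; instances PROVED»).

Pure category theory; nothing here bears on, or takes a side on, [IUTchIII] Cor. 3.12; typed ≠ proved elsewhere.
-/

namespace Literature.AnabelianGeometry.AbsoluteAnabelian

open _root_.CategoryTheory _root_.Quiver

universe v u w

namespace DiagramOfCategories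

variable {V : Type w} [Quiver.{v} V] {V' : Type w} [Quiver.{v} V'] {V'' : Type w} [Quiver.{v} V'']
  {V''' : Type w} [Quiver.{v} V''']
  {F : V ⥤q V'} {G : V' ⥤q V''} {K : V'' ⥤q V'''}
  {D : DiagramOfCategories.{v, u, w} V} {D' : DiagramOfCategories.{v, u, w} V'}
  {D'' : DiagramOfCategories.{v, u, w} V''} {D''' : DiagramOfCategories.{v, u, w} V'''}

/-! ### F-0094 at the printed structural 2-morphisms: instance forms, no hypothesis -/

/-- **The left unitor `Φ ∘ id_𝒟 → Φ` is a 2-isomorphism** (its components are the left unitors of the functors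
`Φ_v`, which are isomorphisms). [cite: MochizukiAbsTopIII2015, Definition 3.5 (v) p.76] -/
theorem TwoMorphism.isIso_leftUnitor (Φ : OneMorphism F D D') :
    Literature.AnabelianGeometry.AbsoluteAnabelian.DiagramOfCategories.TwoMorphism.IsIso
      (TwoMorphism.leftUnitor Φ) := fun a => by
  change CategoryTheory.IsIso (Φ.app a).leftUnitor.hom
  infer_instance

/-- **The right unitor `id_{𝒟'} ∘ Φ → Φ` is a 2-isomorphism.** [cite: MochizukiAbsTopIII2015, Definition 3.5 (v) p.76] -/
theorem TwoMorphism.isIso_rightUnitor (Φ : OneMorphism F D D') :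
    Literature.AnabelianGeometry.AbsoluteAnabelian.DiagramOfCategories.TwoMorphism.IsIso
      (TwoMorphism.rightUnitor Φ) := fun a => by
  change CategoryTheory.IsIso (Φ.app a).rightUnitor.hom
  infer_instance

/-- **The associator `Ξ ∘ (Ψ ∘ Φ) → (Ξ ∘ Ψ) ∘ Φ` is a 2-isomorphism.**
[cite: MochizukiAbsTopIII2015, Definition 3.5 (v) p.76] -/
theorem TwoMorphism.isIso_associator (Φ : OneMorphism F D D') (Ψ : OneMorphism G D' D'')
    (Ξ : OneMorphism K D'' D''') :
    Literature.AnabelianGeometry.AbsoluteAnabelian.DiagramOfCategories.TwoMorphism.IsIso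
      (TwoMorphism.associator Φ Ψ Ξ) := fun a => by
  change CategoryTheory.IsIso (Functor.associator (Φ.app a) (Ψ.app (F.obj a)) (Ξ.app (G.obj (F.obj a)))).inv
  infer_instance

/-- **2-isomorphisms are closed under vertical composition** `Θ₂ ∘ Θ₁` (componentwise composition of
isomorphisms). [cite: MochizukiAbsTopIII2015, Definition 3.5 (v) p.76] -/
theorem TwoMorphism.IsIso.vcomp {Φ Ψ Ξ : OneMorphism F D D'} {Θ₁ : TwoMorphism Φ Ψ} {Θ₂ : TwoMorphism Ψ Ξ}
    (h₁ : Θ₁.IsIso) (h₂ : Θ₂.IsIso) :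
    Literature.AnabelianGeometry.AbsoluteAnabelian.DiagramOfCategories.TwoMorphism.IsIso (Θ₁.vcomp Θ₂) :=
  fun a => by
    haveI := h₁ a
    haveI := h₂ a
    change CategoryTheory.IsIso (Θ₁.app a ≫ Θ₂.app a)
    infer_instance

/-! ### F-0094: the universal closure is false -/

/-- **F-0094, universal closure REFUTED.**  On the one-vertex graph without edges (`Quiver.SingleObj PEmpty`)
let `𝒟` carry the ordered category `Fin 2` (`0 ⟶ 1`, no arrow back).  Between the 1-morphisms (over the identity
graph morphism) "constant at `0`" and "constant at `1`" there is the 2-morphism whose single component is the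
constant natural transformation `0 ⟶ 1`; it is NOT a 2-isomorphism (an inverse would have a component `1 ⟶ 0`).
Hence "`∀ 𝒟 𝒟' Φ Ψ Θ, Θ.IsIso`" is not a theorem: the row is a predicate, to be asserted of specific
2-morphisms only. [cite: MochizukiAbsTopIII2015, Definition 3.5 (v) p.76] -/
theorem TwoMorphism.not_forall_isIso :
    ¬ ∀ (W W' : Type) [Quiver.{0} W] [Quiver.{0} W'] (E : W ⥤q W')
        (𝒟 : DiagramOfCategories.{0, 0, 0} W) (𝒟' : DiagramOfCategories.{0, 0, 0} W')
        (Φ Ψ : OneMorphism E 𝒟 𝒟') (Θ : TwoMorphism Φ Ψ),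
        Literature.AnabelianGeometry.AbsoluteAnabelian.DiagramOfCategories.TwoMorphism.IsIso Θ := by
  intro h
  let 𝒟 : DiagramOfCategories.{0, 0, 0} (Quiver.SingleObj PEmpty.{1}) :=
    { obj := fun _ => Fin 2, cat := fun _ => Preorder.smallCategory (Fin 2), map := fun e => PEmpty.elim e }
  let Φ : OneMorphism (𝟭q (Quiver.SingleObj PEmpty.{1})) 𝒟 𝒟 :=
    { app := fun _ => (Functor.const (Fin 2)).obj (0 : Fin 2), iso := fun e => PEmpty.elim e }
  let Ψ : OneMorphism (𝟭q (Quiver.SingleObj PEmpty.{1})) 𝒟 𝒟 :=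
    { app := fun _ => (Functor.const (Fin 2)).obj (1 : Fin 2), iso := fun e => PEmpty.elim e }
  let θ : (Functor.const (Fin 2)).obj (0 : Fin 2) ⟶ (Functor.const (Fin 2)).obj (1 : Fin 2) :=
    { app := fun _ => homOfLE (show (0 : Fin 2) ≤ 1 by decide)
      naturality := fun _ _ _ => Subsingleton.elim _ _ }
  let Θ : TwoMorphism Φ Ψ := { app := fun _ => θ, naturality := fun e => PEmpty.elim e }
  have hΘ : CategoryTheory.IsIso θ :=
    h _ _ (𝟭q (Quiver.SingleObj PEmpty.{1})) 𝒟 𝒟 Φ Ψ Θ (Quiver.SingleObj.star PEmpty.{1})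
  have back : (1 : Fin 2) ⟶ (0 : Fin 2) := (CategoryTheory.inv θ).app (0 : Fin 2)
  have h10 : (1 : Fin 2) ≤ 0 := leOfHom back
  exact absurd h10 (by decide)

end DiagramOfCategories

end Literature.AnabelianGeometry.AbsoluteAnabelian
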